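import Summits.NavierStokesRegularity.OSWSelfSimilar.CertificateViscousSheetRB
import HarnessLib
/-!
# Z3-SR-CERT, IMPLEMENTATION 2 — the ∃! sentence AT THE SHARP RADII, and «two implementations, one zero» as theorems

HONEST FRAMING (cell ns-blowup GROUP B, zone Z3, case Z3-SR-CERT; profile-lead RULINGS (fc)/(fe)/(fl)): **1-D MODEL (viscous gCLM/OSW sheet on `ℝ` at
`c_l = 1/2`), computer-assisted; not Euler, not Navier–Stokes; «violates: none — MODEL»; census hook `Literature.Analysis.FluidPDE.effectiveViscosity_half`.**
Sibling of `CertificateViscousSheetRB.lean` (implementation 2's literal row: blocks 1–3 = C–S column, sharp-`D` column of record, F5(c) η upgrade; that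
file is at the 400-line cap) and of `CertificateViscousSheetR.lean` (implementation 1) / `CertificateViscousSheetRFixedPoint.lean` (the abstract
fixed-point forms).  THEOREMS ONLY (no new literal): the ∃! sentence AT THE SHARP RADII, and «two implementations, one zero» as theorems
Answers profile-refuter g4's record-only K-notes on file B (STATUS 2026-08-27T02:20Z): (n1) the composed `∃!` sentences of blocks 1–3 sit at the crude
radii `2Kη`; here they are composed at the Newton–Kantorovich radius literals themselves (`rEsharpB`, `rEsharpBR`, `rEsharpBR2`) through selfsim's
self-map form `existsUnique_fixedPoint_quadratic_of_selfMap` (monotone in `(M, ‖g₀‖)`), the self-map inequality `K(η + (L_lip/2)·r♯²) ≤ r♯` being a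
`norm_num` fact on the literals — stated in the `∃! δ, δ ∈ closedBall 0 r♯ ∧ δ = −S(g₀ + Qδδ)` form; (n2) the docstrings' «the two certified zeros coincide» becomes a theorem: under implementation 1's hypotheses
(`‖Sφ‖ ≤ K‖φ‖`, `‖g₀‖ ≤ eta`) the fixed point of `existsUnique_fixedPoint_of_row` (ball `rE`) IS the fixed point of block 1 (ball `rEB ⊇` ball `rE`,
`K ≤ KB`, `eta ≤ etaB`); and under implementation 2's F5(c) hypotheses (`‖Sφ‖ ≤ KBR‖φ‖`, `‖g₀‖ ≤ etaB2`, which imply implementation 1's since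
`KBR ≤ K`, `etaB2 ≤ eta`) the fixed point of `existsUnique_fixedPoint_of_rowBR2` (ball `rEBR2 ⊆` ball `rE`) IS implementation 1's.  MODEL bookkeeping;
not NS; no number of the cell moves.

**What is NOT kernel-checked:** as in both rows — the interval / integer arithmetic behind the literals and the MODEL ASSEMBLY (that the sheet's
solution operator `S`, quadratic part `Q` and residual `g₀ = G(Ω̄)` satisfy the bounds).  WHAT THIS IS NOT: not NS.
-/

noncomputable section

open Metric Set

namespace Summit.NavierStokesRegularity.OSWSelfSimilar
namespace CertificateViscousSheetR

open Literature.Analysis.Calculus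

variable {E : Type*} [NormedAddCommGroup E] [NormedSpace ℝ E] [CompleteSpace E]
variable {Xs : Type*} [NormedAddCommGroup Xs] [NormedSpace ℝ Xs]


/-- block 1 (C–S column): the self-map inequality at the SHARP radius, `KB·(etaB + (Llip/2)·rEsharpB²) ≤ rEsharpB`. [folklore] -/
theorem selfMap_rEsharpB : KB * (etaB + Llip / 2 * rEsharpB ^ 2) ≤ rEsharpB := by norm_num [KB, etaB, Llip, rEsharpB]
/-- block 1: contraction window at the sharp radius, `rEsharpB · KB · Llip < 1`. [folklore] -/
theorem rEsharpB_mul_KB_mul_Llip_lt_one : rEsharpB * KB * Llip < 1 := by norm_num [rEsharpB, KB, Llip]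
/-- block 2 (sharp-`D` column of record): self-map at the sharp radius, `KBR·(etaB + (Llip/2)·rEsharpBR²) ≤ rEsharpBR`. [folklore] -/
theorem selfMap_rEsharpBR : KBR * (etaB + Llip / 2 * rEsharpBR ^ 2) ≤ rEsharpBR := by norm_num [KBR, etaB, Llip, rEsharpBR]
/-- block 2: contraction window at the sharp radius. [folklore] -/
theorem rEsharpBR_mul_KBR_mul_Llip_lt_one : rEsharpBR * KBR * Llip < 1 := by norm_num [rEsharpBR, KBR, Llip]
/-- block 3 (F5(c) η): self-map at the sharp LOCATION radius, `KBR·(etaB2 + (Llip/2)·rEsharpBR2²) ≤ rEsharpBR2`. [folklore] -/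
theorem selfMap_rEsharpBR2 : KBR * (etaB2 + Llip / 2 * rEsharpBR2 ^ 2) ≤ rEsharpBR2 := by norm_num [KBR, etaB2, Llip, rEsharpBR2]
/-- block 3: contraction window at the sharp location radius. [folklore] -/
theorem rEsharpBR2_mul_KBR_mul_Llip_lt_one : rEsharpBR2 * KBR * Llip < 1 := by norm_num [rEsharpBR2, KBR, Llip]
/-- implementation 2's F5(c) hypotheses imply implementation 1's: `KBR ≤ K`. [folklore] -/
theorem KBR_le_K : KBR ≤ K := by norm_num [KBR, K]
/-- implementation 2's F5(c) hypotheses imply implementation 1's: `etaB2 ≤ eta`. [folklore] -/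
theorem etaB2_le_eta : etaB2 ≤ eta := by norm_num [etaB2, eta]
/-- implementation 1's hypotheses imply block 1's: `K ≤ KB`. [folklore] -/
theorem K_le_KB : K ≤ KB := by norm_num [K, KB]
/-- implementation 1's hypotheses imply block 1's: `eta ≤ etaB`. [folklore] -/
theorem eta_le_etaB : eta ≤ etaB := by norm_num [eta, etaB]
/-- implementation 2's F5(c) location ball (crude literal) sits inside implementation 1's crude ball: `rEBR2 ≤ rE`. [folklore] -/
theorem rEBR2_le_rE : rEBR2 ≤ rE := by norm_num [rEBR2, rE]

/-- generic composition at a sharp radius: the self-map form with `M ≤ Llip/2`, `‖g₀‖ ≤ η₀` and literal facts `K₀(η₀ + (Llip/2)r²) ≤ r`,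
`r·K₀·Llip < 1` gives exactly one fixed point in the closed ball of radius `r`. [folklore] -/
theorem existsUnique_fixedPoint_at_sharp (S : Xs →L[ℝ] E) (Q : E →L[ℝ] E →L[ℝ] Xs) (g₀ : Xs) {K₀ η₀ r M : ℝ}
    (hK₀ : 0 ≤ K₀) (hM : 0 < M) (hr0 : 0 ≤ r) (hS : ∀ φ, ‖S φ‖ ≤ K₀ * ‖φ‖) (hQ : ∀ u v, ‖Q u v‖ ≤ M * ‖u‖ * ‖v‖)
    (hLlip : 2 * M ≤ (Llip : ℝ)) (hη : ‖g₀‖ ≤ η₀) (hself : K₀ * (η₀ + (Llip : ℝ) / 2 * r ^ 2) ≤ r) (hwin : r * K₀ * (Llip : ℝ) < 1) :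
    ∃ δ ∈ closedBall (0 : E) r, δ = -S (g₀ + Q δ δ) ∧ ∀ δ' ∈ closedBall (0 : E) r, δ' = -S (g₀ + Q δ' δ') → δ' = δ := by
  have hMle : M ≤ (Llip : ℝ) / 2 := by linarith
  have hself' : K₀ * (η₀ + M * r ^ 2) ≤ r := by
    refine le_trans (mul_le_mul_of_nonneg_left ?_ hK₀) hself
    have : M * r ^ 2 ≤ (Llip : ℝ) / 2 * r ^ 2 := mul_le_mul_of_nonneg_right hMle (sq_nonneg _)
    linarith
  have hwin' : r * K₀ * (2 * M) < 1 := by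
    refine lt_of_le_of_lt ?_ hwin
    exact mul_le_mul_of_nonneg_left hLlip (mul_nonneg hr0 hK₀)
  exact existsUnique_fixedPoint_quadratic_of_selfMap S Q g₀ hK₀ hM.le hS hQ hη hr0 hself' hwin'

/-- (n1) block 1 at its SHARP radius: exactly one `δ` with `‖δ‖ ≤ rEsharpB` (3.76e-3) and `δ = −S(g₀ + Qδδ)`, for `‖Sφ‖ ≤ KB‖φ‖`, `2M ≤ Llip`,
`‖g₀‖ ≤ etaB`.  MODEL; interval arithmetic and model assembly are hypotheses. [folklore] -/
theorem existsUnique_fixedPoint_of_rowB_sharp (S : Xs →L[ℝ] E) (Q : E →L[ℝ] E →L[ℝ] Xs) (g₀ : Xs) {M : ℝ} (hM : 0 < M)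
    (hS : ∀ φ, ‖S φ‖ ≤ (KB : ℝ) * ‖φ‖) (hQ : ∀ u v, ‖Q u v‖ ≤ M * ‖u‖ * ‖v‖) (hLlip : 2 * M ≤ (Llip : ℝ))
    (hη : ‖g₀‖ ≤ (etaB : ℝ)) :
    ∃! δ : E, δ ∈ closedBall (0 : E) (rEsharpB : ℝ) ∧ δ = -S (g₀ + Q δ δ) := by
  have hK₀ : (0 : ℝ) ≤ (KB : ℝ) := by norm_num [KB]
  have hr0 : (0 : ℝ) ≤ (rEsharpB : ℝ) := by norm_num [rEsharpB]
  have hself : (KB : ℝ) * ((etaB : ℝ) + (Llip : ℝ) / 2 * (rEsharpB : ℝ) ^ 2) ≤ (rEsharpB : ℝ) := by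
    have h' := selfMap_rEsharpB; exact_mod_cast h'
  have hwin : (rEsharpB : ℝ) * (KB : ℝ) * (Llip : ℝ) < 1 := by
    have h' := rEsharpB_mul_KB_mul_Llip_lt_one; exact_mod_cast h'
  obtain ⟨δ, hδ, hfix, huniq⟩ := existsUnique_fixedPoint_at_sharp S Q g₀ hK₀ hM hr0 hS hQ hLlip hη hself hwin
  exact ⟨δ, ⟨hδ, hfix⟩, fun δ' h' => huniq δ' h'.1 h'.2⟩

/-- (n1) block 2 (sharp-`D` column of record) at its SHARP radius: exactly one `δ` with `‖δ‖ ≤ rEsharpBR` (3.163e-3), for `‖Sφ‖ ≤ KBR‖φ‖`,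
`2M ≤ Llip`, `‖g₀‖ ≤ etaB`. [folklore] -/
theorem existsUnique_fixedPoint_of_rowBR_sharp (S : Xs →L[ℝ] E) (Q : E →L[ℝ] E →L[ℝ] Xs) (g₀ : Xs) {M : ℝ} (hM : 0 < M)
    (hS : ∀ φ, ‖S φ‖ ≤ (KBR : ℝ) * ‖φ‖) (hQ : ∀ u v, ‖Q u v‖ ≤ M * ‖u‖ * ‖v‖) (hLlip : 2 * M ≤ (Llip : ℝ))
    (hη : ‖g₀‖ ≤ (etaB : ℝ)) :
    ∃! δ : E, δ ∈ closedBall (0 : E) (rEsharpBR : ℝ) ∧ δ = -S (g₀ + Q δ δ) := by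
  have hK₀ : (0 : ℝ) ≤ (KBR : ℝ) := by norm_num [KBR]
  have hr0 : (0 : ℝ) ≤ (rEsharpBR : ℝ) := by norm_num [rEsharpBR]
  have hself : (KBR : ℝ) * ((etaB : ℝ) + (Llip : ℝ) / 2 * (rEsharpBR : ℝ) ^ 2) ≤ (rEsharpBR : ℝ) := by
    have h' := selfMap_rEsharpBR; exact_mod_cast h'
  have hwin : (rEsharpBR : ℝ) * (KBR : ℝ) * (Llip : ℝ) < 1 := by
    have h' := rEsharpBR_mul_KBR_mul_Llip_lt_one; exact_mod_cast h'
  obtain ⟨δ, hδ, hfix, huniq⟩ := existsUnique_fixedPoint_at_sharp S Q g₀ hK₀ hM hr0 hS hQ hLlip hη hself hwin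
  exact ⟨δ, ⟨hδ, hfix⟩, fun δ' h' => huniq δ' h'.1 h'.2⟩

/-- (n1) block 3 (F5(c)) at the SHARP LOCATION radius: exactly one `δ` with `‖δ‖ ≤ rEsharpBR2` (2.642e-6, sup `≤ rSupSharpBR2` = 4.671e-7 by
`rSupSharpBR2_sq_ge` and the weighted embedding), for `‖Sφ‖ ≤ KBR‖φ‖`, `2M ≤ Llip`, `‖g₀‖ ≤ etaB2`. [folklore] -/
theorem existsUnique_fixedPoint_of_rowBR2_sharp (S : Xs →L[ℝ] E) (Q : E →L[ℝ] E →L[ℝ] Xs) (g₀ : Xs) {M : ℝ} (hM : 0 < M)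
    (hS : ∀ φ, ‖S φ‖ ≤ (KBR : ℝ) * ‖φ‖) (hQ : ∀ u v, ‖Q u v‖ ≤ M * ‖u‖ * ‖v‖) (hLlip : 2 * M ≤ (Llip : ℝ))
    (hη : ‖g₀‖ ≤ (etaB2 : ℝ)) :
    ∃! δ : E, δ ∈ closedBall (0 : E) (rEsharpBR2 : ℝ) ∧ δ = -S (g₀ + Q δ δ) := by
  have hK₀ : (0 : ℝ) ≤ (KBR : ℝ) := by norm_num [KBR]
  have hr0 : (0 : ℝ) ≤ (rEsharpBR2 : ℝ) := by norm_num [rEsharpBR2]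
  have hself : (KBR : ℝ) * ((etaB2 : ℝ) + (Llip : ℝ) / 2 * (rEsharpBR2 : ℝ) ^ 2) ≤ (rEsharpBR2 : ℝ) := by
    have h' := selfMap_rEsharpBR2; exact_mod_cast h'
  have hwin : (rEsharpBR2 : ℝ) * (KBR : ℝ) * (Llip : ℝ) < 1 := by
    have h' := rEsharpBR2_mul_KBR_mul_Llip_lt_one; exact_mod_cast h'
  obtain ⟨δ, hδ, hfix, huniq⟩ := existsUnique_fixedPoint_at_sharp S Q g₀ hK₀ hM hr0 hS hQ hLlip hη hself hwin
  exact ⟨δ, ⟨hδ, hfix⟩, fun δ' h' => huniq δ' h'.1 h'.2⟩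

/-- (n2) **TWO IMPLEMENTATIONS, ONE ZERO (F5(a)+(b)), as a theorem**: under implementation 1's hypotheses (`‖Sφ‖ ≤ K‖φ‖`, `2M ≤ Llip`,
`‖g₀‖ ≤ eta`), any fixed point of `δ = −S(g₀ + Qδδ)` in implementation 1's ball `‖δ‖ ≤ rE` and any fixed point in implementation 2's block-1 ball
`‖δ‖ ≤ rEB` are EQUAL (`K ≤ KB`, `eta ≤ etaB`, `rE ≤ rEB` and uniqueness in the larger ball, `existsUnique_fixedPoint_of_rowB`). [folklore] -/
theorem fixedPoint_row_eq_rowB (S : Xs →L[ℝ] E) (Q : E →L[ℝ] E →L[ℝ] Xs) (g₀ : Xs) {M : ℝ} (hM : 0 < M)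
    (hS : ∀ φ, ‖S φ‖ ≤ (K : ℝ) * ‖φ‖) (hQ : ∀ u v, ‖Q u v‖ ≤ M * ‖u‖ * ‖v‖) (hLlip : 2 * M ≤ (Llip : ℝ))
    (hη : ‖g₀‖ ≤ (eta : ℝ)) {δ₁ δ₂ : E}
    (h₁ : δ₁ ∈ closedBall (0 : E) (rE : ℝ)) (h₁' : δ₁ = -S (g₀ + Q δ₁ δ₁))
    (h₂ : δ₂ ∈ closedBall (0 : E) (rEB : ℝ)) (h₂' : δ₂ = -S (g₀ + Q δ₂ δ₂)) : δ₁ = δ₂ := by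
  have hKB : (K : ℝ) ≤ (KB : ℝ) := by exact_mod_cast K_le_KB
  have hetaB : (eta : ℝ) ≤ (etaB : ℝ) := by exact_mod_cast eta_le_etaB
  have hrr : (rE : ℝ) ≤ (rEB : ℝ) := by exact_mod_cast rE_le_rEB
  have hS' : ∀ φ, ‖S φ‖ ≤ (KB : ℝ) * ‖φ‖ := fun φ =>
    (hS φ).trans (mul_le_mul_of_nonneg_right hKB (norm_nonneg _))
  obtain ⟨δ, -, -, huniq⟩ := existsUnique_fixedPoint_of_rowB S Q g₀ hM hS' hQ hLlip (hη.trans hetaB)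
  have h₁B : δ₁ ∈ closedBall (0 : E) (rEB : ℝ) := closedBall_subset_closedBall hrr h₁
  rw [huniq δ₁ h₁B h₁', huniq δ₂ h₂ h₂']

/-- (n2) **TWO IMPLEMENTATIONS, ONE ZERO — LOCATION (F5(c)), as a theorem**: under implementation 2's F5(c) hypotheses (`‖Sφ‖ ≤ KBR‖φ‖`,
`2M ≤ Llip`, `‖g₀‖ ≤ etaB2` — which imply implementation 1's, `KBR ≤ K`, `etaB2 ≤ eta`), any fixed point in implementation 2's location ball
`‖δ‖ ≤ rEBR2` (5.284e-6) and any fixed point in implementation 1's ball `‖δ‖ ≤ rE` (1.189e-5) are EQUAL (`rEBR2 ≤ rE` and uniqueness in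
implementation 1's ball, `existsUnique_fixedPoint_of_row`). [folklore] -/
theorem fixedPoint_rowBR2_eq_row (S : Xs →L[ℝ] E) (Q : E →L[ℝ] E →L[ℝ] Xs) (g₀ : Xs) {M : ℝ} (hM : 0 < M)
    (hS : ∀ φ, ‖S φ‖ ≤ (KBR : ℝ) * ‖φ‖) (hQ : ∀ u v, ‖Q u v‖ ≤ M * ‖u‖ * ‖v‖) (hLlip : 2 * M ≤ (Llip : ℝ))
    (hη : ‖g₀‖ ≤ (etaB2 : ℝ)) {δ₁ δ₂ : E}
    (h₁ : δ₁ ∈ closedBall (0 : E) (rEBR2 : ℝ)) (h₁' : δ₁ = -S (g₀ + Q δ₁ δ₁))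
    (h₂ : δ₂ ∈ closedBall (0 : E) (rE : ℝ)) (h₂' : δ₂ = -S (g₀ + Q δ₂ δ₂)) : δ₁ = δ₂ := by
  have hK : (KBR : ℝ) ≤ (K : ℝ) := by exact_mod_cast KBR_le_K
  have heta : (etaB2 : ℝ) ≤ (eta : ℝ) := by exact_mod_cast etaB2_le_eta
  have hrr : (rEBR2 : ℝ) ≤ (rE : ℝ) := by exact_mod_cast rEBR2_le_rE
  have hS' : ∀ φ, ‖S φ‖ ≤ (K : ℝ) * ‖φ‖ := fun φ =>
    (hS φ).trans (mul_le_mul_of_nonneg_right hK (norm_nonneg _))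
  obtain ⟨δ, -, -, huniq⟩ := existsUnique_fixedPoint_of_row S Q g₀ hM hS' hQ hLlip (hη.trans heta)
  have h₁R : δ₁ ∈ closedBall (0 : E) (rE : ℝ) := closedBall_subset_closedBall hrr h₁
  rw [huniq δ₁ h₁R h₁', huniq δ₂ h₂ h₂']

/-! ### Append (seat ns-blowup-profile-cert-2 g6, 2026-08-27): implementation 2's literals in the WEIGHTED-`L²` PIVOT form, for the MODEL ASSEMBLY

The concrete assembly (`SheetRCertificateAssembly.existsUnique_fixedPoint_assembled`) takes the pivot space `W = L²_w` and the `w → E` constant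
`K_w = KNw/(1 − KNw·epsN)` of implementation 1 (`existsUnique_fixedPoint_of_row_w`).  The same sentence holds with implementation 2's printed
primaries `KNwB`, `epsNBR` (sharp-`D` column of record) and its F5(c) residual literal `etaB2`, AT implementation 2's location literal `rEBR2`
(5.284e-6): `K_wB := KNwB/(1 − KNwB·epsNBR) ≈ 9.595`, and the two rational facts `K_wB·(etaB2 + (Llip/4)·rEBR2²) ≤ rEBR2`, `rEBR2·K_wB·(Llip/2) < 1`
hold (`norm_num`).  No new literal; MODEL bookkeeping; not NS. -/

/-- At implementation 2's literals: `K_wB·(etaB2 + (Llip/4)·rEBR2²) ≤ rEBR2`, `K_wB = KNwB/(1 − KNwB·epsNBR)` (`≈ 9.595·4.1323e-7 = 3.965e-6 ≤ 5.284e-6`).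
[folklore] -/
theorem KwB_selfMap_le : KNwB / (1 - KNwB * epsNBR) * (etaB2 + Llip / 4 * rEBR2 ^ 2) ≤ rEBR2 := by
  norm_num [KNwB, epsNBR, etaB2, Llip, rEBR2]

/-- At implementation 2's literals: `rEBR2·K_wB·(Llip/2) < 1` (`≈ 4.9e-5`). [folklore] -/
theorem KwB_window_lt_one : rEBR2 * (KNwB / (1 - KNwB * epsNBR)) * (Llip / 2) < 1 := by
  norm_num [KNwB, epsNBR, Llip, rEBR2]

/-- `K_wB = KNwB/(1 − KNwB·epsNBR)` is positive. [folklore] -/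
theorem KwB_pos : 0 < KNwB / (1 - KNwB * epsNBR) := by norm_num [KNwB, epsNBR]

/-- **Implementation 2's row, keyed on the weighted `L²` space.**  For ANY real Banach space `E` and normed space `W` (the role of `L²_w`),
solution operator `S : W →L E` with `‖Sg‖_E ≤ K_wB‖g‖_W`, `K_wB = KNwB/(1 − KNwB·epsNBR)` (implementation 2's `‖DG(Ω̄)⁻¹‖_{L²_w→E}` chain), quadratic
part with `‖Q u v‖_W ≤ M_w‖u‖‖v‖`, `4M_w ≤ Llip`, and residual `‖g₀‖_W ≤ etaB2`: the closed `E`-ball of radius `rEBR2` about `0` contains EXACTLY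
ONE solution of `δ = −S(g₀ + Qδδ)`.  (MODEL; interval data and the instantiation are hypotheses.) [folklore] -/
theorem existsUnique_fixedPoint_of_rowBR2_w {W : Type*} [NormedAddCommGroup W] [NormedSpace ℝ W]
    (S : W →L[ℝ] E) (Q : E →L[ℝ] E →L[ℝ] W) (g₀ : W) {Mw : ℝ} (hMw : 0 ≤ Mw)
    (hS : ∀ g, ‖S g‖ ≤ ((KNwB / (1 - KNwB * epsNBR) : ℚ) : ℝ) * ‖g‖) (hQ : ∀ u v, ‖Q u v‖ ≤ Mw * ‖u‖ * ‖v‖)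
    (hLlip : 4 * Mw ≤ (Llip : ℝ)) (hη : ‖g₀‖ ≤ (etaB2 : ℝ)) :
    ∃ δ ∈ closedBall (0 : E) (rEBR2 : ℝ), δ = -S (g₀ + Q δ δ) ∧
      ∀ δ' ∈ closedBall (0 : E) (rEBR2 : ℝ), δ' = -S (g₀ + Q δ' δ') → δ' = δ := by
  set Kw : ℚ := KNwB / (1 - KNwB * epsNBR) with hKw
  have hKw0 : (0 : ℝ) ≤ (Kw : ℝ) := by have h := KwB_pos; rw [hKw]; exact_mod_cast h.le
  have hself0 : (Kw : ℝ) * ((etaB2 : ℝ) + (Llip : ℝ) / 4 * (rEBR2 : ℝ) ^ 2) ≤ (rEBR2 : ℝ) := by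
    have h := KwB_selfMap_le; rw [hKw]; exact_mod_cast h
  have hwin0 : (rEBR2 : ℝ) * (Kw : ℝ) * ((Llip : ℝ) / 2) < 1 := by
    have h := KwB_window_lt_one; rw [hKw]; exact_mod_cast h
  have hr0 : (0 : ℝ) ≤ (rEBR2 : ℝ) := by norm_num [rEBR2]
  have hself : (Kw : ℝ) * (‖g₀‖ + Mw * (rEBR2 : ℝ) ^ 2) ≤ (rEBR2 : ℝ) := by
    refine le_trans (mul_le_mul_of_nonneg_left ?_ hKw0) hself0
    have : Mw * (rEBR2 : ℝ) ^ 2 ≤ (Llip : ℝ) / 4 * (rEBR2 : ℝ) ^ 2 := mul_le_mul_of_nonneg_right (by linarith) (sq_nonneg _)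
    linarith
  have hr' : (rEBR2 : ℝ) * (Kw : ℝ) * (2 * Mw) < 1 := by
    refine lt_of_le_of_lt ?_ hwin0
    exact mul_le_mul_of_nonneg_left (by linarith) (mul_nonneg hr0 hKw0)
  exact existsUnique_fixedPoint_quadratic_of_selfMap S Q g₀ hKw0 hMw hS hQ le_rfl hr0 hself hr'

end CertificateViscousSheetR
end Summit.NavierStokesRegularity.OSWSelfSimilar

end
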